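import Summits.ValiantsHypothesis.ValiantsHypothesis.Theorems.NewtonUnitEquationsTwoProductsRankOneAPLawVeronese
import HarnessLib

/-!
# Route NewtonUnitEquations — crux `TwoProducts` (stmt-ValiantsHypothesis-5906), line `relation_ladder`, rung R6c (three-term
# rank one, arithmetic-progression shape `2β = α + γ`): the VERONESE LIFT — part 2/5 — the slice sums and THE COEFFICIENT THEOREM for the Veronese lift of the truncated logarithm (Part V3)

val-lit-p3 g15 (prover seat, helper mode `--supports stmt-ValiantsHypothesis-5906 --as helper`), 2026-08-28.  Rung R6c of val-idea-8's line
`relation_ladder` (card `Lines/relation_ladder.md` v14 l.28–35; engine memo `Lines/relation_ladder_R6_engine.md` rev 3 §7′: «`2β = α + γ` (3-AP,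
`ρ⁺ = {β,β}`): Veronese `X_α ↦ Z², X_β ↦ ZW, X_γ ↦ W²` after DOUBLING all planar exponents»).  THE THREE-TERM ARITHMETIC-PROGRESSION RANK-ONE
LAW: if ALL additive coincidences of the letter family `A_j = supp u_j ∪ supp v_j` come from ONE relation `α + γ = β + β` among DISTINCT
letters (`RankOneCoincidences A (2·e_β) (e_α + e_γ)`), then GLOBALLY `#visible ≤ 2^{c m} (#T + 2)^c` — the statement shape of R3♯
`permTypeLaw_proof` / R6 `rankOneFourLaw_proof` / R6b `R6b.rankOneThreeLaw_proof`.  MECHANISM: the VERONESE LIFT realises the toric ring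
`ℂ[Y]/(Y_β² − Y_αY_γ)` inside a FREE ring (variables `Z = Y_a`, `W = Y_c`, `Y_b` dead); the planar push-forward `Z ↦ α, W ↦ γ, Y_e ↦ 2e`
DOUBLES every planar exponent INSIDE the push-forward (`phi E' ∘ φ_ver = doubling ∘ phi enum`), so the instance `(u, v)` is never changed and
`ℕ²`-integrality is automatic; rank-one coincidences = injectivity on the lifted support (one level up from R3♯'s `injOn_of_permType`); Lemma A
upstairs = the tree's `toric_minLog`; the fibre of the lift over a balanced exponent is `{#β = k : k ≡ x_Z (mod 2), k ≤ min(x_Z, x_W)}` with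
CONSTANT letter count, and the multinomial regroups as `multinomial(x̂)·C(h,(x_W+k)/2)·C((x_W+k)/2,k)` in the HALF-DEGREE `h = (x_Z+x_W)/2` —
so with the reduced exponent `x̂ = (h @ Z, 0 @ Y_b, 0 @ W, rest)` every slice `b = x_W ≤ 2m` is a plain BINOMIAL-EXPONENTIAL sum of width
`≤ 2m(2m+1)²` (no parity bases, no square roots), counted by val-lit-p3 g14's tool `BinExpSum.binExpPencilCount` (p620797) through the landed
`binExpPencilCount_fintype`; the slice identity `θ(x) = 2·Σ_i (−wt ξ ŝ_i) x̂_i + (Γ − A)·x_W` makes the slice functional affine along the pencil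
of valid weights; degenerate case (a relation letter outside the alphabet) via R3♯.  All statements are by LITERAL body (no parameter-free
`def … : Prop`); generic toolkit (`phiT/piT`, `binChar/bsum/bwidth`, `toric_minLog`, `RankOneCoincidences`, `idxOf`, `rW`, `lwt_*`, `SIdx/tab/sgn`)
and the three-index API (`R6b.ThreeIdx`, `R6b.rest`, `R6b.prod_three_split`, …) are IMPORTED from the landed R6 / R6b ports, not re-declared.
Honest scope: helper layer; nothing here closes the residual of the line, the crux `TwoProducts` (5906) or `VP ≠ VNP`; no summit statement is
proved. [folklore]
-/

noncomputable section

-- Sub = Summit single-conjunct layout: the duplicated namespace component is mandated by the tree.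
set_option linter.dupNamespace false
set_option linter.unusedSimpArgs false

namespace Summit.ValiantsHypothesis.ValiantsHypothesis.Theorems.NewtonUnitEquations.TwoProducts.PermutationType
namespace R6c
open scoped BigOperators
open MvPolynomial

variable {σ : Type*} [Fintype σ] [DecidableEq σ]

variable (J : R6b.ThreeIdx σ)

/-! ## Part V3: the slice sums of the Veronese-lifted truncated logarithm and THE COEFFICIENT THEOREM -/

section Slice
variable {m : ℕ}

/-- Term coefficients of the slice sum: `± C((b+k)/2, k) · c_β^k · c_γ^{(b-k)/2}` for `k ≡ b (mod 2)`, else `0`. [folklore] -/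
def vtermC (c d : Fin m → σ → ℂ) (b : ℕ) : SIdx m b → ℂ :=
  fun τ => if (τ.2 : ℕ) % 2 = b % 2 then
    sgn m τ.1 * ((((b + τ.2) / 2).choose τ.2 : ℕ) : ℂ) * (tab c d τ.1 J.b ^ (τ.2 : ℕ) * tab c d τ.1 J.c ^ ((b - τ.2) / 2))
    else 0

/-- Term bases of the slice sum: `0` on `Y_b, W`, `c_e` elsewhere (in particular `c_α` on `Z`). [folklore] -/
def vtermA (c d : Fin m → σ → ℂ) (b : ℕ) : SIdx m b → σ → ℂ :=
  fun τ j => if j = J.b ∨ j = J.c then 0 else tab c d τ.1 j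

/-- Term binomial degrees of the slice sum: `(b+k)/2` on `Z`, `0` elsewhere. [folklore] -/
def vtermD (b : ℕ) : SIdx m b → σ → ℕ :=
  fun τ j => if j = J.a then (b + τ.2) / 2 else 0

/-- **The slice sum** `F(b; ·)` of the Veronese-lifted truncated logarithm. [folklore] -/
def VFsl (c d : Fin m → σ → ℂ) (b : ℕ) (ν : σ → ℕ) : ℂ :=
  bsum (vtermC J c d b) (vtermA J c d b) (vtermD J b) ν

/-- The width of the slice sum is at most `2 m (b + 1)^2`. [folklore] -/
theorem bwidth_vtermD_le (b : ℕ) : bwidth (vtermD J b : SIdx m b → σ → ℕ) ≤ 2 * m * (b + 1) ^ 2 := by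
  unfold bwidth
  have hterm : ∀ τ : SIdx m b, ∏ j, (vtermD J b τ j + 1) ≤ b + 1 := by
    intro τ
    rw [R6b.prod_three_split J]
    have hr : ∏ j ∈ R6b.rest J, (vtermD J b τ j + 1) = 1 := by
      refine Finset.prod_eq_one fun j hj => ?_
      rw [R6b.mem_rest] at hj
      simp [vtermD, hj.1]
    rw [hr, one_mul]
    have ha : vtermD J b τ J.a = (b + τ.2) / 2 := by simp [vtermD]
    have hb : vtermD J b τ J.b = 0 := by simp [vtermD, J.hab.symm]
    have hc : vtermD J b τ J.c = 0 := by simp [vtermD, J.hac.symm]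
    rw [ha, hb, hc]
    have h2 := τ.2.isLt
    calc ((b + (τ.2 : ℕ)) / 2 + 1) * ((0 + 1) * (0 + 1)) = (b + (τ.2 : ℕ)) / 2 + 1 := by ring
      _ ≤ b + 1 := by omega
  calc ∑ τ : SIdx m b, ∏ j, (vtermD J b τ j + 1) ≤ ∑ _τ : SIdx m b, (b + 1) :=
        Finset.sum_le_sum fun τ _ => hterm τ
    _ = (2 * m * (b + 1)) * (b + 1) := by
        rw [Finset.sum_const, Finset.card_univ, smul_eq_mul]
        simp [Fintype.card_prod, Fintype.card_sum, Fintype.card_fin]; ring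
    _ = 2 * m * (b + 1) ^ 2 := by ring

/-- **Per-term evaluation** of the slice sum at a reduced exponent `x̂` (slice `b = x_c`): the term `(t, k)` equals
`± [k ≡ x_c] · C(h, (x_c+k)/2) C((x_c+k)/2, k) · mom (tab t) (VLof x k)`, `h = (x_a + x_c)/2`. [folklore] -/
theorem vterm_eval (c d : Fin m → σ → ℂ) (x : σ →₀ ℕ) (hx : VBal J x) (τ : SIdx m (x J.c)) :
    vtermC J c d (x J.c) τ * ∏ j, binChar (vtermA J c d (x J.c) τ j) (vtermD J (x J.c) τ j) (vhat J x j) =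
      if (τ.2 : ℕ) % 2 = x J.c % 2 then
        sgn m τ.1 * ((((x J.a + x J.c) / 2).choose ((x J.c + τ.2) / 2) * ((x J.c + τ.2) / 2).choose τ.2 : ℕ) : ℂ) *
          mom (tab c d τ.1) (VLof J x τ.2)
      else 0 := by
  have hk : (τ.2 : ℕ) ≤ x J.c := Nat.lt_succ_iff.mp τ.2.isLt
  have hx' : x J.b = 0 ∧ (x J.a + x J.c) % 2 = 0 := hx
  by_cases hpar : (τ.2 : ℕ) % 2 = x J.c % 2
  swap
  · rw [if_neg hpar]; unfold vtermC; rw [if_neg hpar, zero_mul]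
  rw [if_pos hpar]
  unfold mom
  rw [R6b.prod_three_split J, R6b.prod_three_split J]
  -- the three special factors of the binomial product
  have hAa : vtermA J c d (x J.c) τ J.a = tab c d τ.1 J.a := by simp [vtermA, J.hab, J.hac]
  have hAb : vtermA J c d (x J.c) τ J.b = 0 := by simp [vtermA]
  have hAc : vtermA J c d (x J.c) τ J.c = 0 := by simp [vtermA]
  have hDa : vtermD J (x J.c) τ J.a = (x J.c + τ.2) / 2 := by simp [vtermD]
  have hDb : vtermD J (x J.c) τ J.b = 0 := by simp [vtermD, J.hab.symm]
  have hDc : vtermD J (x J.c) τ J.c = 0 := by simp [vtermD, J.hac.symm]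
  rw [hAa, hAb, hAc, hDa, hDb, hDc, vhat_a, vhat_b, vhat_c, VLof_a, VLof_b, VLof_c, binChar_base_zero, if_pos rfl]
  -- the remaining factors agree
  have hr : ∏ j ∈ R6b.rest J, binChar (vtermA J c d (x J.c) τ j) (vtermD J (x J.c) τ j) (vhat J x j) =
      ∏ j ∈ R6b.rest J, tab c d τ.1 j ^ (VLof J x τ.2) j := by
    refine Finset.prod_congr rfl fun j hj => ?_
    rw [R6b.mem_rest] at hj
    rw [VLof_other J x _ j hj.1 hj.2.1 hj.2.2, vhat_other J x j hj.1 hj.2.1 hj.2.2]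
    have hA : vtermA J c d (x J.c) τ j = tab c d τ.1 j := by simp [vtermA, hj.2.1, hj.2.2]
    have hD : vtermD J (x J.c) τ j = 0 := by simp [vtermD, hj.1]
    rw [hA, hD, binChar_zero_deg]
  rw [hr]
  unfold vtermC
  rw [if_pos hpar]
  rcases Nat.lt_or_ge (x J.a) τ.2 with hlt | hge
  · -- degenerate: `k > x_a`, both sides vanish through `C(h, (x_c+k)/2) = 0`
    have hdh : (x J.a + x J.c) / 2 < (x J.c + τ.2) / 2 := by omega
    rw [Nat.choose_eq_zero_of_lt hdh]
    unfold binChar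
    rw [Nat.choose_eq_zero_of_lt hdh]
    push_cast
    ring
  · have e1 : (x J.a + x J.c) / 2 - (x J.c + τ.2) / 2 = (x J.a - τ.2) / 2 := by omega
    unfold binChar
    rw [e1]
    push_cast
    ring

/-- **The slice sum at a reduced exponent** is the binomially weighted fibre sum of moment differences. [folklore] -/
theorem VFsl_vhat_eq (c d : Fin m → σ → ℂ) (x : σ →₀ ℕ) (hx : VBal J x) :
    VFsl J c d (x J.c) (vhat J x) = ∑ k ∈ Finset.range (x J.c + 1),
      if k % 2 = x J.c % 2 then
        ((((x J.a + x J.c) / 2).choose ((x J.c + k) / 2) * ((x J.c + k) / 2).choose k : ℕ) : ℂ) *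
          (∑ j, mom (c j) (VLof J x k) - ∑ j, mom (d j) (VLof J x k))
      else 0 := by
  unfold VFsl bsum
  rw [Fintype.sum_prod_type_right]
  rw [← Fin.sum_univ_eq_sum_range (fun k => if k % 2 = x J.c % 2 then
        ((((x J.a + x J.c) / 2).choose ((x J.c + k) / 2) * ((x J.c + k) / 2).choose k : ℕ) : ℂ) *
          (∑ j, mom (c j) (VLof J x k) - ∑ j, mom (d j) (VLof J x k)) else 0) (x J.c + 1)]
  refine Finset.sum_congr rfl fun k _ => ?_
  rw [Fintype.sum_sum_type]
  simp only [vterm_eval J c d x hx]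
  by_cases hpar : (k : ℕ) % 2 = x J.c % 2
  · simp only [if_pos hpar, sgn, tab, Sum.elim_inl, Sum.elim_inr, one_mul, neg_one_mul, neg_mul,
      Finset.sum_neg_distrib, ← Finset.mul_sum]
    ring
  · simp only [if_neg hpar, Finset.sum_const_zero, add_zero]

omit [Fintype σ] [DecidableEq σ] in
/-- The admissible range sits inside `range (x_c + 1)`. [folklore] -/
theorem VKR_subset_range (x : σ →₀ ℕ) : VKR J x ⊆ Finset.range (x J.c + 1) := by
  intro k hk
  rw [mem_VKR] at hk
  exact Finset.mem_range.mpr (by omega)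

/-- **THE COEFFICIENT THEOREM (Veronese).** For a balanced exponent `x` whose reduced degree `n = deg x̂` lies in `[1, R]`,
the coefficient of `Y^x` in the Veronese lift of the truncated logarithm is `(-1)^{n+1}/n · multinomial(x̂) · F(x_c; x̂)`.
[folklore] -/
theorem coeff_veronese_logTrunc (c d : Fin m → σ → ℂ) (R : ℕ) (x : σ →₀ ℕ) (hx : VBal J x)
    (h1 : 1 ≤ deg (vhat J x)) (hR : deg (vhat J x) ≤ R) :
    coeff x (phiT (verM J) (logTrunc c d R)) =
      ((-1 : ℂ) ^ (deg (vhat J x) + 1) / (deg (vhat J x) : ℂ)) * ((vhat J x).multinomial : ℂ) *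
        VFsl J c d (x J.c) (vhat J x) := by
  classical
  have hx' : x J.b = 0 ∧ (x J.a + x J.c) % 2 = 0 := hx
  rw [coeff_phiT]
  -- Step 1: reindex the fibre sum by `k = #β ∈ VKR x`
  have step1 : ∑ L ∈ (logTrunc c d R).support with piT (verM J) L = x, coeff L (logTrunc c d R) =
      ∑ k ∈ VKR J x, coeff (VLof J x k) (logTrunc c d R) := by
    rw [← Finset.sum_filter_add_sum_filter_not (VKR J x) (fun k => VLof J x k ∈ (logTrunc c d R).support)]
    rw [Finset.sum_eq_zero (s := (VKR J x).filter fun k => ¬ VLof J x k ∈ (logTrunc c d R).support)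
      (fun k hk => notMem_support_iff.mp (Finset.mem_filter.mp hk).2), add_zero]
    apply Finset.sum_nbij' (fun L => L J.b) (fun k => VLof J x k)
    · intro L hL
      rw [Finset.mem_filter] at hL
      obtain ⟨hk, hLeq⟩ := eq_VLof_of_piT J L x hL.2
      rw [Finset.mem_filter, ← hLeq]
      exact ⟨hk, hL.1⟩
    · intro k hk
      rw [Finset.mem_filter] at hk
      rw [Finset.mem_filter]
      exact ⟨hk.2, piT_VLof J x hx k hk.1⟩
    · intro L hL
      rw [Finset.mem_filter] at hL
      exact (eq_VLof_of_piT J L x hL.2).2.symm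
    · intro k _
      exact VLof_b J x k
    · intro L hL
      rw [Finset.mem_filter] at hL
      obtain ⟨-, hLeq⟩ := eq_VLof_of_piT J L x hL.2
      rw [← hLeq]
  rw [step1]
  -- Step 2: evaluate each fibre coefficient and regroup the multinomial
  have step2 : ∀ k ∈ VKR J x, coeff (VLof J x k) (logTrunc c d R) =
      ((-1 : ℂ) ^ (deg (vhat J x) + 1) / (deg (vhat J x) : ℂ)) * (((vhat J x).multinomial : ℂ) *
        (((((x J.a + x J.c) / 2).choose ((x J.c + k) / 2) * ((x J.c + k) / 2).choose k : ℕ) : ℂ) *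
          (∑ j, mom (c j) (VLof J x k) - ∑ j, mom (d j) (VLof J x k)))) := by
    intro k hk
    have hdeg := deg_VLof J x hx k hk
    rw [coeff_logTrunc c d R _ (by rw [hdeg]; exact h1) (by rw [hdeg]; exact hR), hdeg, multinomial_VLof J x hx k hk]
    push_cast; ring
  rw [Finset.sum_congr rfl step2, ← Finset.mul_sum, ← Finset.mul_sum, VFsl_vhat_eq J c d x hx]
  -- Step 3: the weights vanish off `VKR x`
  have step3 : (∑ k ∈ Finset.range (x J.c + 1),
      if k % 2 = x J.c % 2 then
        ((((x J.a + x J.c) / 2).choose ((x J.c + k) / 2) * ((x J.c + k) / 2).choose k : ℕ) : ℂ) *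
          (∑ j, mom (c j) (VLof J x k) - ∑ j, mom (d j) (VLof J x k))
      else 0) =
      ∑ k ∈ VKR J x, ((((x J.a + x J.c) / 2).choose ((x J.c + k) / 2) * ((x J.c + k) / 2).choose k : ℕ) : ℂ) *
          (∑ j, mom (c j) (VLof J x k) - ∑ j, mom (d j) (VLof J x k)) := by
    rw [← Finset.sum_subset (VKR_subset_range J x) (fun k hk hnk => by
      rw [mem_VKR] at hnk
      have hk' : k ≤ x J.c := Nat.lt_succ_iff.mp (Finset.mem_range.mp hk)
      by_cases hpar : k % 2 = x J.c % 2
      · rw [if_pos hpar]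
        have hka : x J.a < k := by
          by_contra hcon
          exact hnk ⟨by omega, hk', by omega⟩
        have : ((x J.a + x J.c) / 2).choose ((x J.c + k) / 2) = 0 := Nat.choose_eq_zero_of_lt (by omega)
        rw [this, zero_mul, Nat.cast_zero, zero_mul]
      · rw [if_neg hpar])]
    refine Finset.sum_congr rfl fun k hk => ?_
    rw [mem_VKR] at hk
    rw [if_pos (by omega)]
  rw [step3]
  ring

/-- The support criterion: a balanced `x` with reduced degree in `[1, R]` lies in the support of the Veronese-lifted
truncated logarithm iff its slice sum does not vanish at `x̂`. [folklore] -/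
theorem mem_support_veronese_logTrunc_iff (c d : Fin m → σ → ℂ) (R : ℕ) (x : σ →₀ ℕ) (hx : VBal J x)
    (h1 : 1 ≤ deg (vhat J x)) (hR : deg (vhat J x) ≤ R) :
    x ∈ (phiT (verM J) (logTrunc c d R)).support ↔ VFsl J c d (x J.c) (vhat J x) ≠ 0 := by
  rw [mem_support_iff, coeff_veronese_logTrunc J c d R x hx h1 hR]
  have hk : (deg (vhat J x) : ℂ) ≠ 0 := Nat.cast_ne_zero.mpr (by omega)
  have hc : ((-1 : ℂ) ^ (deg (vhat J x) + 1) / (deg (vhat J x) : ℂ)) ≠ 0 :=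
    div_ne_zero (pow_ne_zero _ (neg_ne_zero.mpr one_ne_zero)) hk
  have hm := multinomial_cast_ne_zero (vhat J x)
  constructor
  · intro h hF; exact h (by rw [hF, mul_zero])
  · intro h; exact mul_ne_zero (mul_ne_zero hc hm) h

/-- Non-vanishing of a slice sum forces `ν_b = ν_c = 0` and `b ≤ 2 ν_a`. [folklore] -/
theorem shape_of_VFsl_ne_zero (c d : Fin m → σ → ℂ) (b : ℕ) (ν : σ → ℕ) (h : VFsl J c d b ν ≠ 0) :
    ν J.b = 0 ∧ ν J.c = 0 ∧ b ≤ 2 * ν J.a := by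
  by_contra hcon
  apply h
  unfold VFsl bsum
  refine Finset.sum_eq_zero fun τ _ => ?_
  have hAb : vtermA J c d b τ J.b = 0 := by simp [vtermA]
  have hAc : vtermA J c d b τ J.c = 0 := by simp [vtermA]
  have hDa : vtermD J b τ J.a = (b + τ.2) / 2 := by simp [vtermD]
  have hDb : vtermD J b τ J.b = 0 := by simp [vtermD, J.hab.symm]
  have hDc : vtermD J b τ J.c = 0 := by simp [vtermD, J.hac.symm]
  by_cases hb : ν J.b = 0
  · by_cases hc : ν J.c = 0
    · have hlt : 2 * ν J.a < b := by omega
      by_cases hpar : (τ.2 : ℕ) % 2 = b % 2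
      · rw [mul_eq_zero]; right
        exact Finset.prod_eq_zero (Finset.mem_univ J.a) (by rw [hDa]; exact binChar_eq_zero_of_lt _ _ _ (by omega))
      · rw [mul_eq_zero]; left
        unfold vtermC; rw [if_neg hpar]
    · rw [mul_eq_zero]; right
      exact Finset.prod_eq_zero (Finset.mem_univ J.c) (by rw [hAc, hDc, binChar_base_zero, if_neg hc])
  · rw [mul_eq_zero]; right
    exact Finset.prod_eq_zero (Finset.mem_univ J.b) (by rw [hAb, hDb, binChar_base_zero, if_neg hb])

/-- The slice sum vanishes at the origin of the slice `b = 0` (equal numbers of `±` atoms). [folklore] -/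
theorem VFsl_zero_zero (c d : Fin m → σ → ℂ) (ν : σ → ℕ) (hν : ∀ j, ν j = 0) : VFsl J c d 0 ν = 0 := by
  unfold VFsl bsum
  have : ∀ τ : SIdx m 0, vtermC J c d 0 τ * ∏ j, binChar (vtermA J c d 0 τ j) (vtermD J 0 τ j) (ν j) = sgn m τ.1 := by
    intro τ
    have hk : (τ.2 : ℕ) = 0 := by have := τ.2.isLt; omega
    have hprod : ∏ j, binChar (vtermA J c d 0 τ j) (vtermD J 0 τ j) (ν j) = 1 := by
      refine Finset.prod_eq_one fun j _ => ?_
      have hD : vtermD J 0 τ j = 0 := by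
        unfold vtermD; split_ifs <;> simp [hk]
      rw [hD, hν j]; simp [binChar]
    rw [hprod, mul_one]; unfold vtermC; rw [hk]; simp
  simp only [this]
  rw [Fintype.sum_prod_type, Fintype.sum_sum_type]
  simp [sgn]

/-- The balanced exponent with prescribed slice `b` and reduced part `ν` (`ν_b = ν_c = 0`, `b ≤ 2ν_a`). [folklore] -/
def vxOf (b : ℕ) (ν : σ → ℕ) : σ →₀ ℕ :=
  ofFun fun j => if j = J.a then 2 * ν J.a - b else if j = J.b then 0 else if j = J.c then b else ν j

/-- The prescribed slice coordinate. [folklore] -/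
theorem vxOf_c (b : ℕ) (ν : σ → ℕ) : vxOf J b ν J.c = b := by
  simp [vxOf, J.hac.symm, J.hbc.symm]

/-- `vxOf b ν` is balanced. [folklore] -/
theorem vxOf_vbal (b : ℕ) (ν : σ → ℕ) (hb : b ≤ 2 * ν J.a) : VBal J (vxOf J b ν) := by
  unfold VBal vxOf
  simp [J.hab.symm, J.hac.symm, J.hbc.symm]
  omega

/-- The reduced part of `vxOf b ν` is `ν`. [folklore] -/
theorem vhat_vxOf (b : ℕ) (ν : σ → ℕ) (hb : b ≤ 2 * ν J.a) (hνb : ν J.b = 0) (hνc : ν J.c = 0) :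
    ⇑(vhat J (vxOf J b ν)) = ν := by
  funext j
  by_cases hja : j = J.a
  · subst hja; rw [vhat_a]; simp [vxOf, J.hac.symm, J.hbc.symm]; omega
  by_cases hjb : j = J.b
  · subst hjb; rw [vhat_b, hνb]
  by_cases hjc : j = J.c
  · subst hjc; rw [vhat_c, hνc]
  rw [vhat_other J _ j hja hjb hjc]
  simp [vxOf, hja, hjb, hjc]

/-- A balanced exponent is recovered from its slice and its reduced part. [folklore] -/
theorem vxOf_vhat (x : σ →₀ ℕ) (hx : VBal J x) : vxOf J (x J.c) (vhat J x) = x := by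
  have hx' : x J.b = 0 ∧ (x J.a + x J.c) % 2 = 0 := hx
  ext j
  by_cases hja : j = J.a
  · subst hja; simp [vxOf, vhat_a]; omega
  by_cases hjb : j = J.b
  · subst hjb; simp [vxOf, J.hab.symm]; omega
  by_cases hjc : j = J.c
  · subst hjc; rw [vxOf_c]
  simp [vxOf, hja, hjb, hjc, vhat_other J x j hja hjb hjc]

end Slice

end R6c
end Summit.ValiantsHypothesis.ValiantsHypothesis.Theorems.NewtonUnitEquations.TwoProducts.PermutationType

end
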